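import Summits.Ventures.LatticeQCDFlow.Exactness.ReversibleVariationalSupTauInt
import HarnessLib

/-!
# Subsampling cannot help: the `V`-thinned autocorrelation sum of a reversible exact sampler is at least `1/V` of the full one, `τ_int^{(V)} + ½ ≥ (τ_int + ½)/V`

HONEST FRAMING: exact (Metropolis-corrected) sampling algorithms for lattice gauge theory;
figures of merit are autocorrelation/cost numbers at stated couplings and volumes; no
continuum-physics claim.  (SCALAR calibration rung S0-A: not a gauge result.)

Venture `LatticeQCDFlow` (cell pub-lqcd), topic `Exactness`; FANOUT row 2 (`s0-phi4`).  NEW WORK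
of the cell over `Exactness/ReversibleVariationalSup(TauInt).lean` (least-constant characterisation
of the Abel sum) and `Exactness/ReversibleAutocovMonotone.lean` (`C(0) − C(n) ≤ n (C(0) − C(1))`,
gen-13) in the `RevOp` format.  Nothing is cited as a fact; elementary.  Printed counterparts NAMED
ONLY: Geyer 1992 (*Practical Markov chain Monte Carlo*, Statist. Sci. 7, Thm 3.3) and
MacEachern–Berliner 1994 (*Subsampling the Gibbs sampler*, Amer. Statist. 48): for a reversible
chain, using every `V`-th state increases the asymptotic variance at fixed computing effort
(`V·v^{(V)}(f) ≥ v(f)`; in `τ` units `V(2τ^{(V)} + 1) − 1 ≥ 2τ`, sharper than the form below by an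
additive `(V − 1)/(2V)`).  Here: the comparison of a sampler `K` with its own power `K^V` through
the least-constant theorem — `Q^{(V)}_r(v) ≤ V · Q_r(v)` on the class — in Abel form without
summability, for every observable of an admissible class.

## What is proved (namespace `RevOp`; `C(k) = ∫ g (Kᵏ g) w`; thinned series `k ↦ C(Vk)`)

* `quadForm_iterate_le_mul` — `∫ v² w − r ∫ v (K^V v) w ≤ V · (∫ v² w − r ∫ v (K v) w)` for
  `v ∈ A`, `0 ≤ r ≤ 1`, `V ≥ 1`;
* **`abelSum_le_mul_thinned_abelSum`** (unconditional) — for every `g ∈ A`, `0 ≤ r < 1`, `V ≥ 1`: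
  **`Σ_k C(k) rᵏ ≤ V · Σ_k C(Vk) rᵏ`**;
* **`tsum_le_mul_thinned_tsum`**, **`tauInt_add_half_le_mul_thinned`** — under summability of both
  series (`P > 0`):  `Σ_k C(k) ≤ V Σ_k C(Vk)`, i.e. **`τ_int(g) + ½ ≤ V · (τ_int^{(V)}(g) + ½)`**.

Reading (no numerics implied): the tree states the local arm's floors per SWEEP (`V` proposals,
thinned series) and gen-18's comparisons per PROPOSAL; this file is the one-way bridge — every
per-proposal lower bound `τ_prop + ½ ≥ X` is a per-sweep lower bound `τ_sweep + ½ ≥ X/V`, for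
every observable and every reversible exact sampler (the converse direction is false: a period-two
mode is frozen under even thinning).  For the scorers: recording one configuration per sweep can
never make a chain look more than `V` times faster in `τ + ½` than it is per proposal.
NOT CLAIMED: Geyer's sharper constant; an upper bound of the thinned sum by the full one (false in
general); non-reversible updates; any number for any run.
-/

namespace Summit.Ventures.LatticeQCDFlow.Exactness

open Real MeasureTheory Filter Finset Topology
open Summit.Ventures.LatticeQCDFlow.Scoring

namespace RevOp

variable {X : Type*} [MeasurableSpace X] {μ : Measure X} {w : X → ℝ} {A : (X → ℝ) → Prop}
  {K : (X → ℝ) → (X → ℝ)}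

/-- **`Q^{(V)}_r(v) ≤ V · Q_r(v)`**: `∫ v² w − r ∫ v (K^V v) w ≤ V (∫ v² w − r ∫ v (K v) w)` for
`v ∈ A`, `0 ≤ r ≤ 1`, `1 ≤ V` (from `C_v(0) − C_v(V) ≤ V (C_v(0) − C_v(1))`). -/
theorem quadForm_iterate_le_mul (hw0 : ∀ x, 0 ≤ w x)
    (hAi : ∀ ⦃f h : X → ℝ⦄, A f → A h → Integrable (fun x => f x * h x * w x) μ)
    (hAc : ∀ ⦃f h : X → ℝ⦄ (c : ℝ), A f → A h → A (fun x => f x + c * h x))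
    (hAK : ∀ ⦃f : X → ℝ⦄, A f → A (K f))
    (hlin : ∀ ⦃f h : X → ℝ⦄ (c : ℝ), A f → A h →
      ∀ x, K (fun s => f s + c * h s) x = K f x + c * K h x)
    (hsymm : ∀ ⦃f h : X → ℝ⦄, A f → A h →
      ∫ x, K f x * h x * w x ∂μ = ∫ x, f x * K h x * w x ∂μ)
    (hcontr : ∀ ⦃f : X → ℝ⦄, A f → ∫ x, K f x ^ 2 * w x ∂μ ≤ ∫ x, f x ^ 2 * w x ∂μ)
    {v : X → ℝ} (hv : A v) {r : ℝ} (hr0 : 0 ≤ r) (hr1 : r ≤ 1) {V : ℕ} (hV : 1 ≤ V) :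
    (∫ x, v x ^ 2 * w x ∂μ) - r * ∫ x, v x * (K^[V] v) x * w x ∂μ
      ≤ (V : ℝ) * ((∫ x, v x ^ 2 * w x ∂μ) - r * ∫ x, v x * K v x * w x ∂μ) := by
  have hdef := autocov_deficit_le hw0 hAi hAc hAK hlin hsymm hcontr hv V
  have hP0 : 0 ≤ ∫ x, v x ^ 2 * w x ∂μ := integral_nonneg fun x => mul_nonneg (sq_nonneg _) (hw0 x)
  have hV' : (1 : ℝ) ≤ (V : ℝ) := by exact_mod_cast hV
  set P := ∫ x, v x ^ 2 * w x ∂μ with hP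
  set C1 := ∫ x, v x * K v x * w x ∂μ with hC1
  set CV := ∫ x, v x * (K^[V] v) x * w x ∂μ with hCV
  -- `X = V C1 − CV ≤ (V − 1) P`
  have hX : (V : ℝ) * C1 - CV ≤ ((V : ℝ) - 1) * P := by linarith
  nlinarith [mul_nonneg hr0 (sub_nonneg.2 hX),
    mul_nonneg (sub_nonneg.2 hr1) (mul_nonneg (sub_nonneg.2 hV') hP0)]

/-- **SUBSAMPLING CANNOT HELP, ABEL FORM (unconditional).**  For every `g ∈ A`, `0 ≤ r < 1` and
`V ≥ 1`:  `Σ_k C(k) rᵏ ≤ V · Σ_k C(Vk) rᵏ`. -/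
theorem abelSum_le_mul_thinned_abelSum (hw0 : ∀ x, 0 ≤ w x)
    (hAi : ∀ ⦃f h : X → ℝ⦄, A f → A h → Integrable (fun x => f x * h x * w x) μ)
    (hAc : ∀ ⦃f h : X → ℝ⦄ (c : ℝ), A f → A h → A (fun x => f x + c * h x))
    (hAK : ∀ ⦃f : X → ℝ⦄, A f → A (K f))
    (hlin : ∀ ⦃f h : X → ℝ⦄ (c : ℝ), A f → A h →
      ∀ x, K (fun s => f s + c * h s) x = K f x + c * K h x)
    (hsymm : ∀ ⦃f h : X → ℝ⦄, A f → A h →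
      ∫ x, K f x * h x * w x ∂μ = ∫ x, f x * K h x * w x ∂μ)
    (hcontr : ∀ ⦃f : X → ℝ⦄, A f → ∫ x, K f x ^ 2 * w x ∂μ ≤ ∫ x, f x ^ 2 * w x ∂μ)
    {g : X → ℝ} (hg : A g) {r : ℝ} (hr0 : 0 ≤ r) (hr1 : r < 1) {V : ℕ} (hV : 1 ≤ V) :
    ∑' k, (∫ x, g x * (K^[k] g) x * w x ∂μ) * r ^ k
      ≤ (V : ℝ) * ∑' k, (∫ x, g x * (K^[V * k] g) x * w x ∂μ) * r ^ k := by
  -- `K^V` is again in the format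
  have hAK' : ∀ ⦃f : X → ℝ⦄, A f → A (K^[V] f) := fun f hf => iterate_mem hAK V hf
  have hlin' : ∀ ⦃f h : X → ℝ⦄ (c : ℝ), A f → A h →
      ∀ x, K^[V] (fun s => f s + c * h s) x = (K^[V] f) x + c * (K^[V] h) x :=
    fun f h c hf hh => iterate_add_mul hAK hlin c V hf hh
  have hsymm' : ∀ ⦃f h : X → ℝ⦄, A f → A h →
      ∫ x, (K^[V] f) x * h x * w x ∂μ = ∫ x, f x * (K^[V] h) x * w x ∂μ :=
    fun f h hf hh => iterate_symm hAK hsymm V hf hh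
  have hcontr' : ∀ ⦃f : X → ℝ⦄, A f → ∫ x, (K^[V] f) x ^ 2 * w x ∂μ ≤ ∫ x, f x ^ 2 * w x ∂μ :=
    fun f hf => iterate_contr hAK hcontr V hf
  set AV := ∑' k, (∫ x, g x * ((K^[V])^[k] g) x * w x ∂μ) * r ^ k with hAV
  have hAV0 : 0 ≤ AV := abelSum_nonneg hw0 hAi hAK' hsymm' hcontr' hg hr0 hr1
  have heq : ∑' k, (∫ x, g x * (K^[V * k] g) x * w x ∂μ) * r ^ k = AV := by
    simp only [hAV, ← Function.iterate_mul]
  rw [heq]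
  refine abelSum_le_of_forall_sq_inner_le hw0 hAi hAc hAK hlin hsymm hcontr hg hr0 hr1
    (mul_nonneg (Nat.cast_nonneg V) hAV0) fun v hv => ?_
  have h := sq_inner_le_abelSum_mul_quadForm hw0 hAi hAc hAK' hlin' hsymm' hcontr' hg hv hr0 hr1
  have hQ := quadForm_iterate_le_mul hw0 hAi hAc hAK hlin hsymm hcontr hv hr0 hr1.le hV
  calc (∫ x, g x * v x * w x ∂μ) ^ 2
      ≤ AV * ((∫ x, v x ^ 2 * w x ∂μ) - r * ∫ x, v x * (K^[V] v) x * w x ∂μ) := h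
    _ ≤ AV * ((V : ℝ) * ((∫ x, v x ^ 2 * w x ∂μ) - r * ∫ x, v x * K v x * w x ∂μ)) :=
        mul_le_mul_of_nonneg_left hQ hAV0
    _ = (V : ℝ) * AV * ((∫ x, v x ^ 2 * w x ∂μ) - r * ∫ x, v x * K v x * w x ∂μ) := by ring

/-- **`Σ_k C(k) ≤ V · Σ_k C(Vk)`** when both the full and the `V`-thinned autocovariance series are
summable (`P > 0`, `V ≥ 1`). -/
theorem tsum_le_mul_thinned_tsum (hw0 : ∀ x, 0 ≤ w x)
    (hAi : ∀ ⦃f h : X → ℝ⦄, A f → A h → Integrable (fun x => f x * h x * w x) μ)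
    (hAc : ∀ ⦃f h : X → ℝ⦄ (c : ℝ), A f → A h → A (fun x => f x + c * h x))
    (hAK : ∀ ⦃f : X → ℝ⦄, A f → A (K f))
    (hlin : ∀ ⦃f h : X → ℝ⦄ (c : ℝ), A f → A h →
      ∀ x, K (fun s => f s + c * h s) x = K f x + c * K h x)
    (hsymm : ∀ ⦃f h : X → ℝ⦄, A f → A h →
      ∫ x, K f x * h x * w x ∂μ = ∫ x, f x * K h x * w x ∂μ)
    (hcontr : ∀ ⦃f : X → ℝ⦄, A f → ∫ x, K f x ^ 2 * w x ∂μ ≤ ∫ x, f x ^ 2 * w x ∂μ)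
    {g : X → ℝ} (hg : A g) (hP : 0 < ∫ x, g x ^ 2 * w x ∂μ) {V : ℕ} (hV : 1 ≤ V)
    (hs : Summable fun n => (∫ x, g x * (K^[n + 1] g) x * w x ∂μ) / ∫ x, g x ^ 2 * w x ∂μ)
    (hsV : Summable fun n => (∫ x, g x * (K^[V * (n + 1)] g) x * w x ∂μ) / ∫ x, g x ^ 2 * w x ∂μ) :
    ∑' k, ∫ x, g x * (K^[k] g) x * w x ∂μ ≤ (V : ℝ) * ∑' k, ∫ x, g x * (K^[V * k] g) x * w x ∂μ := by
  have hAK' : ∀ ⦃f : X → ℝ⦄, A f → A (K^[V] f) := fun f hf => iterate_mem hAK V hf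
  have hlin' : ∀ ⦃f h : X → ℝ⦄ (c : ℝ), A f → A h →
      ∀ x, K^[V] (fun s => f s + c * h s) x = (K^[V] f) x + c * (K^[V] h) x :=
    fun f h c hf hh => iterate_add_mul hAK hlin c V hf hh
  have hsymm' : ∀ ⦃f h : X → ℝ⦄, A f → A h →
      ∫ x, (K^[V] f) x * h x * w x ∂μ = ∫ x, f x * (K^[V] h) x * w x ∂μ :=
    fun f h hf hh => iterate_symm hAK hsymm V hf hh
  have hcontr' : ∀ ⦃f : X → ℝ⦄, A f → ∫ x, (K^[V] f) x ^ 2 * w x ∂μ ≤ ∫ x, f x ^ 2 * w x ∂μ :=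
    fun f hf => iterate_contr hAK hcontr V hf
  -- rewrite the thinned series through `(K^V)^[k]`
  have hiter : ∀ k, (K^[V])^[k] = K^[V * k] := fun k => (Function.iterate_mul K V k).symm
  have hsV' : Summable fun n => (∫ x, g x * ((K^[V])^[n + 1] g) x * w x ∂μ) / ∫ x, g x ^ 2 * w x ∂μ :=
    hsV.congr fun n => by rw [hiter]
  -- the full series: summable and with nonnegative sum
  have hsρ : Summable fun k => (∫ x, g x * (K^[k] g) x * w x ∂μ) / ∫ x, g x ^ 2 * w x ∂μ :=
    (summable_nat_add_iff 1).1 hs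
  have hsC : Summable fun k => ∫ x, g x * (K^[k] g) x * w x ∂μ :=
    (hsρ.mul_left (∫ x, g x ^ 2 * w x ∂μ)).congr fun k => mul_div_cancel₀ _ hP.ne'
  -- nonnegativity of the thinned sum
  have hsρV : Summable fun k => (∫ x, g x * ((K^[V])^[k] g) x * w x ∂μ) / ∫ x, g x ^ 2 * w x ∂μ :=
    (summable_nat_add_iff 1).1 hsV'
  have hC0 : (∫ x, g x * ((K^[V])^[0] g) x * w x ∂μ) = ∫ x, g x ^ 2 * w x ∂μ := by
    simp only [Function.iterate_zero, id_eq]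
    exact integral_congr_ae (Eventually.of_forall fun x => by ring)
  have hTV0 : 0 ≤ ∑' k, ∫ x, g x * ((K^[V])^[k] g) x * w x ∂μ := by
    have h1 : ∑' k, (∫ x, g x * ((K^[V])^[k] g) x * w x ∂μ) / ∫ x, g x ^ 2 * w x ∂μ
        = tauInt (fun n => (∫ x, g x * ((K^[V])^[n] g) x * w x ∂μ) / ∫ x, g x ^ 2 * w x ∂μ)
          + 1 / 2 := by
      rw [hsρV.tsum_eq_zero_add, hC0, div_self hP.ne']
      simp only [tauInt]
      ring
    have h2 := tauInt_ge_neg_half hw0 hAi hAK' hsymm' hcontr' hg hsV'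
    have h3 : 0 ≤ (∑' k, ∫ x, g x * ((K^[V])^[k] g) x * w x ∂μ) / ∫ x, g x ^ 2 * w x ∂μ := by
      rw [← tsum_div_const, h1]; linarith
    exact (div_nonneg_iff.1 h3).elim (fun h => h.1) fun h => absurd h.2 (not_le.2 hP)
  have heq : ∑' k, ∫ x, g x * (K^[V * k] g) x * w x ∂μ = ∑' k, ∫ x, g x * ((K^[V])^[k] g) x * w x ∂μ :=
    tsum_congr fun k => by rw [hiter]
  rw [heq]
  have hdivV : (∑' k, (∫ x, g x * ((K^[V])^[k] g) x * w x ∂μ) / ∫ x, g x ^ 2 * w x ∂μ)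
      = (∑' k, ∫ x, g x * ((K^[V])^[k] g) x * w x ∂μ) / ∫ x, g x ^ 2 * w x ∂μ := tsum_div_const
  refine tsum_le_of_forall_sq_inner_le_dirichlet hAi hAc hAK hlin hsymm hg hsC
    (mul_nonneg (Nat.cast_nonneg V) hTV0) fun v hv => ?_
  have h := sq_inner_le_tsum_mul_dirichlet hw0 hAi hAc hAK' hlin' hsymm' hcontr' hg hv hsV'
  rw [hdivV, ← mul_assoc, mul_div_cancel₀ _ hP.ne'] at h
  have hQ := quadForm_iterate_le_mul hw0 hAi hAc hAK hlin hsymm hcontr hv zero_le_one le_rfl hV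
  rw [one_mul, one_mul] at hQ
  calc (∫ x, g x * v x * w x ∂μ) ^ 2
      ≤ (∑' k, ∫ x, g x * ((K^[V])^[k] g) x * w x ∂μ)
          * ((∫ x, v x ^ 2 * w x ∂μ) - ∫ x, v x * (K^[V] v) x * w x ∂μ) := h
    _ ≤ (∑' k, ∫ x, g x * ((K^[V])^[k] g) x * w x ∂μ)
          * ((V : ℝ) * ((∫ x, v x ^ 2 * w x ∂μ) - ∫ x, v x * K v x * w x ∂μ)) :=
        mul_le_mul_of_nonneg_left hQ hTV0
    _ = (V : ℝ) * (∑' k, ∫ x, g x * ((K^[V])^[k] g) x * w x ∂μ)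
          * ((∫ x, v x ^ 2 * w x ∂μ) - ∫ x, v x * K v x * w x ∂μ) := by ring

/-- **SUBSAMPLING CANNOT HELP (`τ_int`).**  `g ∈ A` with `C_g(0) > 0`, `V ≥ 1`, the full and the
`V`-thinned normalised autocorrelation series both summable.  Then
`τ_int(g) + ½ ≤ V · (τ_int^{(V)}(g) + ½)` — the per-sweep (`V`-thinned) integrated autocorrelation
time is at least `1/V` of the per-proposal one, up to the `½`s. -/
theorem tauInt_add_half_le_mul_thinned (hw0 : ∀ x, 0 ≤ w x)
    (hAi : ∀ ⦃f h : X → ℝ⦄, A f → A h → Integrable (fun x => f x * h x * w x) μ)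
    (hAc : ∀ ⦃f h : X → ℝ⦄ (c : ℝ), A f → A h → A (fun x => f x + c * h x))
    (hAK : ∀ ⦃f : X → ℝ⦄, A f → A (K f))
    (hlin : ∀ ⦃f h : X → ℝ⦄ (c : ℝ), A f → A h →
      ∀ x, K (fun s => f s + c * h s) x = K f x + c * K h x)
    (hsymm : ∀ ⦃f h : X → ℝ⦄, A f → A h →
      ∫ x, K f x * h x * w x ∂μ = ∫ x, f x * K h x * w x ∂μ)
    (hcontr : ∀ ⦃f : X → ℝ⦄, A f → ∫ x, K f x ^ 2 * w x ∂μ ≤ ∫ x, f x ^ 2 * w x ∂μ)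
    {g : X → ℝ} (hg : A g) (hP : 0 < ∫ x, g x ^ 2 * w x ∂μ) {V : ℕ} (hV : 1 ≤ V)
    (hs : Summable fun n => (∫ x, g x * (K^[n + 1] g) x * w x ∂μ) / ∫ x, g x ^ 2 * w x ∂μ)
    (hsV : Summable fun n => (∫ x, g x * (K^[V * (n + 1)] g) x * w x ∂μ) / ∫ x, g x ^ 2 * w x ∂μ) :
    tauInt (fun n => (∫ x, g x * (K^[n] g) x * w x ∂μ) / ∫ x, g x ^ 2 * w x ∂μ) + 1 / 2
      ≤ (V : ℝ) * (tauInt (fun n => (∫ x, g x * (K^[V * n] g) x * w x ∂μ) / ∫ x, g x ^ 2 * w x ∂μ)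
        + 1 / 2) := by
  have hmain := tsum_le_mul_thinned_tsum hw0 hAi hAc hAK hlin hsymm hcontr hg hP hV hs hsV
  have hsρ : Summable fun k => (∫ x, g x * (K^[k] g) x * w x ∂μ) / ∫ x, g x ^ 2 * w x ∂μ :=
    (summable_nat_add_iff 1).1 hs
  have hsρV : Summable fun k => (∫ x, g x * (K^[V * k] g) x * w x ∂μ) / ∫ x, g x ^ 2 * w x ∂μ :=
    (summable_nat_add_iff 1).1 (hsV.congr fun n => by ring_nf)
  have hC0 : (∫ x, g x * (K^[0] g) x * w x ∂μ) = ∫ x, g x ^ 2 * w x ∂μ := by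
    simp only [Function.iterate_zero, id_eq]
    exact integral_congr_ae (Eventually.of_forall fun x => by ring)
  have hCV0 : (∫ x, g x * (K^[V * 0] g) x * w x ∂μ) = ∫ x, g x ^ 2 * w x ∂μ := by
    simp only [Nat.mul_zero, Function.iterate_zero, id_eq]
    exact integral_congr_ae (Eventually.of_forall fun x => by ring)
  have h1 : (∑' k, ∫ x, g x * (K^[k] g) x * w x ∂μ) / ∫ x, g x ^ 2 * w x ∂μ
      = tauInt (fun n => (∫ x, g x * (K^[n] g) x * w x ∂μ) / ∫ x, g x ^ 2 * w x ∂μ) + 1 / 2 := by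
    rw [← tsum_div_const, hsρ.tsum_eq_zero_add, hC0, div_self hP.ne']
    simp only [tauInt]
    ring
  have h1V : (∑' k, ∫ x, g x * (K^[V * k] g) x * w x ∂μ) / ∫ x, g x ^ 2 * w x ∂μ
      = tauInt (fun n => (∫ x, g x * (K^[V * n] g) x * w x ∂μ) / ∫ x, g x ^ 2 * w x ∂μ) + 1 / 2 := by
    rw [← tsum_div_const, hsρV.tsum_eq_zero_add, hCV0, div_self hP.ne']
    simp only [tauInt]
    ring
  rw [← h1, ← h1V, mul_div_assoc', div_le_div_iff_of_pos_right hP]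
  exact hmain

end RevOp

end Summit.Ventures.LatticeQCDFlow.Exactness
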